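import Literature.NumberTheory.GaloisRepresentations.IdeleProjectionS
import Literature.Algebra.Homology.DiscreteRepRestrictionExact
import Literature.Algebra.Homology.DiscreteRepContinuous
import HarnessLib

/-!
# The three local objects of the `S`-idèle localisation at a finite place `v`: the decomposition map
# `φ_v : Γ_{K_v} → G_S`, the discrete module `𝔾_{m,v} = K̄_vˣ` in `C_{Γ_{K_v}}`, and the idèle projection
# `pr_v : φ_v^* Ī_S ⟶ 𝔾_{m,v}` as a morphism of `C_{Γ_{K_v}}` (Harari Prop. 17.25/17.26, Milne I Lemma 4.13)

Topic `NumberTheory/GaloisRepresentations`; namespace `Literature.NumberTheory.GaloisRepresentations.IdeleReadout`.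
Three definitions with bodies and their unfolding lemmas; NO named fact, no `sorry`, no instance, no
notation; number fields in `Type`.  A packaging sequel of -w6 g10's `IdeleProjectionS` (`finIdelePiS K S v :
I_S →+ K̄_vˣ`, `res_v`-equivariant: `finIdelePiS_repr_mk`) for the category-level consumers of lane
«PT-Ш-S-TC» (crux `GoodLatticeBDPValue`, stmt-BirchSwinnertonDyer-19032, cell bsd-eis): the localisation
maps `ExtLocalization.locMap (fun v => Res_{φ_v}) (fun v => pr_v)` of the `Ext` road (bricks (Λ1) -w7 g13,
(Λ2)/E3–E4 -w3 g18 / -w4 g20) all pull back along ONE decomposition map per place and project with ONE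
morphism; this file fixes them:

* `decompMapS K S v : Γ_{K_v} →* G_S` = `Γ_{K_v} → Γ_K ↠ Γ_K ⧸ N_S` (`absGaloisRestrict` then
  `toUnramifiedQuot`), `continuous_decompMapS`, `decompMapS_apply`;
* `unitsD L : DiscreteRepCat ℤ Γ_L` = the discrete Galois module `K̄ˣ` (`units L`) as an object of
  door-c4's `C_{Γ_L}` (`DiscreteRep.ofDiscreteGaloisModule`), `unitsD_ρ_apply`;
* **`finIdelePiSD K S v : (resDHom ℤ (decompMapS K S v) _).obj (truncIdeleBarD K S) ⟶ unitsD (K_v)`**, the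
  idèle projection `π_v|_{I_S}` as a `Γ_{K_v}`-equivariant morphism (equivariance = `finIdelePiS_repr_mk`),
  `finIdelePiSD_hom_hom_apply`, `finIdelePiSD_eq_zero_of_not_mem` (`v ∉ S`);
* §2 the same at ANY place `w : Place K` (for `Place`-indexed local families, archimedean components
  included — needed in degree `0`): `decompMapPlaceS`, `continuous_decompMapPlaceS`, **`idelePiPlaceSD K S w`**
  (door-c6's `ideleProjection K w` restricted to `I_S`), `idelePiPlaceSD_hom_hom_apply`,
  `idelePiPlaceSD_inr_hom_hom_apply` (= `finIdelePiS`), `idelePiPlaceSD_inl_hom_hom_apply` (= `archIdelePiS`),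
  `idelePiPlaceSD_inr_eq_zero_of_not_mem`.

HONEST FRAMING: repackaging only; no arithmetic statement and nothing about BSD is proved here.

## References
* D. Harari, *Galois Cohomology and Class Field Theory*, Universitext (2020), §17.5 Lemma 17.23,
  Prop. 17.25, Prop. 17.26. [Harari2020]
* J. S. Milne, *Arithmetic Duality Theorems*, 2nd ed. (2006), I §4, Lemma 4.13. [MilneADT2006]
-/

noncomputable section

open NumberField IsDedekindDomain Field CategoryTheory
open Literature.Algebra.Homology
open scoped Classical

namespace Literature.NumberTheory.GaloisRepresentations

namespace IdeleReadout

open DiscreteGaloisModule IdeleClassBar DiscreteRep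

variable (K : Type) [Field K] [NumberField K] (S : Finset (HeightOneSpectrum (𝓞 K))) (v : HeightOneSpectrum (𝓞 K))

/-- **The decomposition map `φ_v : Γ_{K_v} → G_S`**: restriction to `K̄` followed by the projection
`Γ_K ↠ G_S = Γ_K ⧸ N_S`. [cite: Harari2020, §17.5 Lemma 17.23][cite: MilneADT2006, I Lemma 4.13] -/
def decompMapS : absoluteGaloisGroup (v.adicCompletion K) →*
    GaloisGroupUnramifiedOutside K (↑S : Set (HeightOneSpectrum (𝓞 K))) :=
  (toUnramifiedQuot K (↑S : Set (HeightOneSpectrum (𝓞 K)))).comp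
    (absGaloisRestrict K (v.adicCompletion K) : absoluteGaloisGroup (v.adicCompletion K) →* absoluteGaloisGroup K)

/-- Formula: `φ_v σ = [res_v σ]`. [cite: Harari2020, §17.5 Lemma 17.23] -/
@[simp]
theorem decompMapS_apply (σ : absoluteGaloisGroup (v.adicCompletion K)) :
    decompMapS K S v σ = QuotientGroup.mk (absGaloisRestrict K (v.adicCompletion K) σ) := rfl

/-- `φ_v` is continuous. [cite: Harari2020, §17.5 Lemma 17.23] -/
theorem continuous_decompMapS : Continuous (decompMapS K S v) :=
  (continuous_toUnramifiedQuot K _).comp (map_continuous (absGaloisRestrict K (v.adicCompletion K)))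

/-- **`𝔾_m = K̄ˣ` as an object of `C_{Γ_L}`** (the discrete Galois module `units L` of the tree).
[cite: Harari2020, §17.5 Prop. 17.25][cite: MilneADT2006, I Lemma 4.13] -/
abbrev unitsD (L : Type) [Field L] : DiscreteRepCat ℤ (absoluteGaloisGroup L) :=
  DiscreteRep.ofDiscreteGaloisModule (units L)

/-- The action on `unitsD L` is that of `units L`. [cite: Harari2020, §17.5 Prop. 17.25] -/
theorem unitsD_ρ_apply (L : Type) [Field L] (σ : absoluteGaloisGroup L) (u : UnitsCarrier L) :
    (unitsD L).obj.ρ σ u = units L σ u := rfl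

/-- **The idèle projection `pr_v : φ_v^* Ī_S ⟶ 𝔾_{m,v}` in `C_{Γ_{K_v}}`** — -w6's `finIdelePiS` with its
`res_v`-equivariance `finIdelePiS_repr_mk`. [cite: Harari2020, §17.5 Prop. 17.25, Prop. 17.26 (proof)]
[cite: MilneADT2006, I Lemma 4.13 (proof)] -/
def finIdelePiSD :
    (resDHom ℤ (decompMapS K S v) (continuous_decompMapS K S v)).obj (truncIdeleBarD K S) ⟶
      unitsD (v.adicCompletion K) :=
  ObjectProperty.homMk (Rep.ofHom
    { toLinearMap := (finIdelePiS K S v).toIntLinearMap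
      isIntertwining' := fun σ => LinearMap.ext fun z => by
        change finIdelePiS K S v (truncIdeleBarRepr K S (decompMapS K S v σ) z) =
          units (v.adicCompletion K) σ (finIdelePiS K S v z)
        exact finIdelePiS_repr_mk K S v σ z })

/-- Formula: `pr_v` IS `finIdelePiS` on vectors. [cite: Harari2020, §17.5 Prop. 17.26 (proof)] -/
@[simp]
theorem finIdelePiSD_hom_hom_apply (z : truncIdeleBar K S) :
    (finIdelePiSD K S v).hom.hom z = finIdelePiS K S v z := rfl

/-- `pr_v = 0` for `v ∉ S`. [cite: Harari2020, Lemma 15.39, Prop. 17.26] -/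
theorem finIdelePiSD_eq_zero_of_not_mem (hv : v ∉ S) : finIdelePiSD K S v = 0 := by
  apply ObjectProperty.hom_ext
  apply Rep.hom_ext
  apply DFunLike.ext
  intro z
  exact finIdelePiS_eq_zero_of_not_mem K S v hv z


/-! ## §2 The same at an arbitrary place `v : Place K` (finite or infinite), for `Place`-indexed local families -/

section AnyPlace

variable (w : Place K)

/-- **The decomposition map `φ_w : Γ_{K_w} → G_S` at any place** (`Place.Completion w` = `K_v` or `ℝ`/`ℂ`).
[cite: Harari2020, §17.5 Lemma 17.23][cite: MilneADT2006, I Lemma 4.13] -/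
def decompMapPlaceS : absoluteGaloisGroup (Place.Completion w) →*
    GaloisGroupUnramifiedOutside K (↑S : Set (HeightOneSpectrum (𝓞 K))) :=
  (toUnramifiedQuot K (↑S : Set (HeightOneSpectrum (𝓞 K)))).comp
    (absGaloisRestrict K (Place.Completion w) : absoluteGaloisGroup (Place.Completion w) →* absoluteGaloisGroup K)

/-- Formula. [cite: Harari2020, §17.5 Lemma 17.23] -/
@[simp]
theorem decompMapPlaceS_apply (σ : absoluteGaloisGroup (Place.Completion w)) :
    decompMapPlaceS K S w σ = QuotientGroup.mk (absGaloisRestrict K (Place.Completion w) σ) := rfl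

/-- `φ_w` is continuous. [cite: Harari2020, §17.5 Lemma 17.23] -/
theorem continuous_decompMapPlaceS : Continuous (decompMapPlaceS K S w) :=
  (continuous_toUnramifiedQuot K _).comp (map_continuous (absGaloisRestrict K (Place.Completion w)))

/-- **The idèle projection `pr_w : φ_w^* Ī_S ⟶ 𝔾_{m,w}` at any place**, door-c6's `ideleProjection K w`
restricted to `I_S`, with its `res_w`-equivariance `IdeleProjection.map_rep`.
[cite: Harari2020, §17.5 Prop. 17.25, Prop. 17.26 (proof)][cite: MilneADT2006, I Lemma 4.13 (proof)] -/
def idelePiPlaceSD :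
    (resDHom ℤ (decompMapPlaceS K S w) (continuous_decompMapPlaceS K S w)).obj (truncIdeleBarD K S) ⟶
      unitsD (Place.Completion w) :=
  ObjectProperty.homMk (Rep.ofHom
    { toLinearMap :=
        ((ideleProjection K w).toAddMonoidHom.comp (truncIdeleBar K S).subtype).toIntLinearMap
      isIntertwining' := fun σ => LinearMap.ext fun z =>
        (ideleProjection K w).map_rep σ ((truncIdeleBar K S).subtype z) })

/-- Formula: `pr_w z = π_w z`. [cite: Harari2020, §17.5 Prop. 17.26 (proof)] -/
@[simp]
theorem idelePiPlaceSD_hom_hom_apply (z : truncIdeleBar K S) :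
    (idelePiPlaceSD K S w).hom.hom z =
      (ideleProjection K w).toAddMonoidHom ((truncIdeleBar K S).subtype z) := rfl

/-- At a finite place the `Place`-indexed projection IS `finIdelePiS` on vectors.
[cite: Harari2020, §17.5 Prop. 17.26 (proof)] -/
theorem idelePiPlaceSD_inr_hom_hom_apply (z : truncIdeleBar K S) :
    (idelePiPlaceSD K S (Sum.inr v)).hom.hom z = finIdelePiS K S v z := rfl

/-- At an infinite place it is `archIdelePiS` on vectors. [cite: Harari2020, §17.5 Prop. 17.26 (proof)] -/
theorem idelePiPlaceSD_inl_hom_hom_apply (u : InfinitePlace K) (z : truncIdeleBar K S) :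
    (idelePiPlaceSD K S (Sum.inl u)).hom.hom z = archIdelePiS K S u z := rfl

/-- `pr_w = 0` at a finite place `w = v ∉ S`. [cite: Harari2020, Lemma 15.39, Prop. 17.26] -/
theorem idelePiPlaceSD_inr_eq_zero_of_not_mem (hv : v ∉ S) : idelePiPlaceSD K S (Sum.inr v) = 0 := by
  apply ObjectProperty.hom_ext
  apply Rep.hom_ext
  apply DFunLike.ext
  intro z
  exact finIdelePiS_eq_zero_of_not_mem K S v hv z

end AnyPlace

end IdeleReadout

end Literature.NumberTheory.GaloisRepresentations

end
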